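import Summits.QuantumFields.YangMills.Theorems.BalabanUVNodesN15KingModelFullPropagatorGradSourceHolderProfile
import Summits.QuantumFields.YangMills.Theorems.BalabanUVNodesN15KingModelFullPropagatorMixedOperator

/-!
# BalabanUVNodes ∕ N15 — THE KING-MODEL RUNG, CURVED EDITION (PART W-b): [B9] (3.43), SECOND HALF, AT `U ≡ 1` — THE HÖLDER ENTRY OF THE
# TRANSPOSED GRADIENT `G∇*_νλ` OF KING'S FULL `A = 0` PROPAGATOR: `(|x − x′|∕N)^{−α}·|(A₀⁻¹∇*_νλ)(x′) − (A₀⁻¹∇*_νλ)(x)| ≤ C(α)·e^{−δ·dist({B(x),B(x′)}, supp λ)}·‖λ‖_∞`,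
# `0 < α < 1`, UNIFORMLY in `K`, the volume and the mass — the (1.9)-SHAPE for the ADJOINT-derivative entry, which [Ba 4] does not print
# (Track A, DAG node N15 = NE2; FAN-OUT v1.1 §N15 s3 «KING-MODEL RUNG … + the one-line statement of what the curved case adds»)

HONEST FRAMING.  Count-neutral kernel bookkeeping (cell `pub-ymgap`, seat `pub-ymgap-dag-n15-e` g9; `--supports stmt-QuantumFields-20544
--as helper` = K3⁷ `SpineGivenEndpointR13SepCoPH`, WORDS-143).  TEMPLATE LITERATURE, `A = 0`: C. King's scalar U(1)-Higgs MODEL on finite tori ([King1986]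
(2.13) p. 653, (3.62) p. 663, Prop. 3.7 (3.65) p. 663), NOT Bałaban's covariant objects.  [Balaban1985BackgroundPropagators] Thm 3.1 (3.43) p. 398 prints the TWO
Hölder norms `‖ζ∇_UGλ‖_β`, `‖ζG∇*_Uλ‖_β ≤ B₀(β)(L^jη)^{1−β}…e^{−δ₀d(y,y′)}|λ|`, `0 ≤ β ≤ β₀ < 1` (tree `B9.KernelFamily.h1`, `B9.Ineq343_345` clause 1); the first
at `U ≡ 1` is [Ba 4] (1.9) (parts U-ii ∕ U-b); the second — the Hölder continuity of `G∇*λ = (∇G)ᵀλ` in the observation point — has no [Ba 4] counterpart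
((1.9) p. 573 is for `D^η_{A,μ}G_kf` only).  The statement below is that second display for King's full `A = 0` propagator at `U ≡ 1`, one-scale sources,
decided in the MODEL; NOT the printed proposition; NE2⁺ is NOT PRINTED and not proved here; NOT a node discharge; nothing continuum ∕ ℝ⁴ ∕ OS ∕ mass-gap ∕
Clay.  0 `sorry`, 0 `def`, standard axioms.

THE PROOF.  Part Q4a `inv_mulVec_adjDeriv_eq_sum` (summation by parts + symmetry): `(A₀⁻¹∇*_νλ)(x) = Σ_y N^{−(d+1)}·N·[G(y + e_ν, x) − G(y, x)]·λ(y)`; by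
`constrainedProp_symm` the kernel is the SOURCE gradient `∂^{(2)}_νG(x, y)`, so the difference at `x′, x` is part W-a's object, whose weighted profile
`(ρ∕N)^{−α}|∂^{(2)}_νG(x′, y) − ∂^{(2)}_νG(x, y)| ≤ C₀Σ_{i<K}(ΛL)^i(L^i)^α e^{−δ₀ m_y L^i∕N}` (`fullPropD2_holder_profile_unif`) is summed against `|λ(y)| ≤ F`: the
block decay from the support comes out of every level's exponential (R-d `exp_level_split`, `N·D ≤ m_y + N − 1`), and level `i` then costs
`N^{−(d+1)}(L^d)^i(L^i)^α·2(8(d+1)N∕(δ₁L^i))^{d+1} = A·(L^{α−1})^i` (V-b `latticeConst_le_of_le` at the rate `δ₁L^i∕2N`, both observation points) —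
geometric since `α < 1`.
* §1 ★★★ **`fullPropAdjOp_holder_le`** — `0 < α < 1`: `∃ C δ > 0 ∀ K ≥ 1 ∀ N = L^K ∀ cube 2L^e ∀ 0 < m² ≤ m₀² ∀ ν ∀ λ, |λ| ≤ F ∀ x x′ ∀ D`, if `λ` vanishes on
  the fine points whose block is within torus distance `< D` of `B(x)` or of `B(x′)`:
  `(|x − x′|∕N)^{−α}·|(A₀⁻¹∇*_νλ)(x′) − (A₀⁻¹∇*_νλ)(x)| ≤ C·e^{−δD}·F`, `(∇*_νλ)(y) = N(λ(y − e_ν) − λ(y))`.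
WHAT THE CURVED CASE ADDS (one line): (3.43)'s second norm for `G(U)∇*_U` uniformly over `Reg335`, multiscale sites (printed; no η-rate).
HONEST SCOPE.  (i) `A = 0`, periodic b.c., odd `L ≥ 3`, cubes `2L^e`, `K ≥ 1`, `0 < m² ≤ m₀²`; (ii) King's spelling of `A₀`; forward η-differences; sup
torus distance; weight in unit coordinates of level `K`; (iii) block-distance currency for «dist({x, x′}, supp λ)»; (iv) `0 < α < 1` (`α = 1` not claimed);
(v) not Bałaban's `G(U)`; not a discharge.
Locators: [Balaban1985BackgroundPropagators] Thm 3.1 (3.43) p. 398; [Balaban1983RegularityDecay] Theorem (1.9)–(1.10) p. 573; [King1986] (2.13) p. 653,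
(3.62), Prop. 3.7 (3.65) p. 663, (4.42)–(4.44) p. 675.
-/

noncomputable section

namespace Summit.QuantumFields.YangMills.BalabanUVNodes.N15KingModelRung.Curved

open Real Finset Matrix
open Literature.MathematicalPhysics.QuantumFieldTheory.Balaban1983to89 (Params)
open Literature.MathematicalPhysics.QuantumFieldTheory.Balaban1983to89.B4Sect5Proof (latticeConst)
open Literature.MathematicalPhysics.QuantumFieldTheory.Balaban1983to89.B5Prop11Plancherel (Tor fine unitVec)
open Literature.MathematicalPhysics.QuantumFieldTheory.King1986 (aK aK_pos)
open Literature.MathematicalPhysics.QuantumFieldTheory.King1986.Torus (fineOp constrainedProp blockOf tdistT tdistT_nonneg tdistT_symm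
  tdistT_sumBound)

variable {d : ℕ} (L : ℕ) [NeZero L]

/-! ## §1 (3.43), second half, at `U ≡ 1` -/

/-- **[B9] (3.43), SECOND HÖLDER NORM, AT `U ≡ 1` FOR KING'S FULL `A = 0` FLUCTUATION PROPAGATOR — the (1.9)-shape for `G∇*_νλ`.**  For odd `L ≥ 3`,
`a > 0`, a mass cap `m₀² ≥ 0` and `0 < α < 1` there are `C, δ > 0` (functions of `d, L, a, m₀², α`) such that for EVERY `K ≥ 1` (spelling `N = L^K`), cube
`M_μ = 2L^e`, mass `0 < m² ≤ m₀²`, direction `ν`, every source `λ` with `|λ| ≤ F`, all fine points `x, x′` and every `D` such that `λ` vanishes on the fine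
points whose unit block is within torus distance `< D` of the block of `x` or of the block of `x′`:
`(|x − x′|∕N)^{−α}·|(A₀⁻¹∇*_νλ)(x′) − (A₀⁻¹∇*_νλ)(x)| ≤ C·e^{−δD}·F`, `(∇*_νλ)(y) = N(λ(y − e_ν) − λ(y))`, `A₀⁻¹ = (fineOp N M a_K N² m²)⁻¹` — the Hölder
quotient of order `α` of the transposed-gradient entry with the decay from «dist({x, x′}, supp λ)», uniformly in `K`, the volume and the mass.
[cite: Balaban1985BackgroundPropagators, Thm 3.1 (3.43) p.398; Balaban1983RegularityDecay, Theorem (1.9) p.573; King1986, (2.13) p.653, (3.62) p.663, Prop. 3.7 (3.65) p.663] -/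
theorem fullPropAdjOp_holder_le (hLodd : Odd L) (hL : 2 ≤ L) {a : ℝ} (ha : 0 < a) {m0sq : ℝ} (hm0 : 0 ≤ m0sq)
    {α : ℝ} (hα0 : 0 < α) (hα1 : α < 1) :
    ∃ C δ : ℝ, 0 < C ∧ 0 < δ ∧ ∀ (K : ℕ), 1 ≤ K → ∀ (N : ℕ) [NeZero N], N = L ^ K →
      ∀ (e : ℕ) (M : Fin (d + 1) → ℕ) [∀ μ, NeZero (M μ)], (∀ μ, M μ = 2 * L ^ e) →
      ∀ (msq : ℝ), 0 < msq → msq ≤ m0sq → ∀ (ν : Fin (d + 1)) (lam : Tor (fine N M) → ℝ) (F D : ℝ),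
        (∀ y, |lam y| ≤ F) → ∀ x x' : Tor (fine N M),
        (∀ y, lam y ≠ 0 → D ≤ tdistT M (blockOf N M x) (blockOf N M y)) →
        (∀ y, lam y ≠ 0 → D ≤ tdistT M (blockOf N M x') (blockOf N M y)) →
        (tdistT (fine N M) x x' / (N : ℝ)) ^ (-α) *
          |((fineOp N M (aK a L K) (((N : ℕ) : ℝ) ^ 2) msq)⁻¹ *ᵥ (fun y => (N : ℝ) * (lam (y - unitVec (fine N M) ν) - lam y))) x'
            - ((fineOp N M (aK a L K) (((N : ℕ) : ℝ) ^ 2) msq)⁻¹ *ᵥ (fun y => (N : ℝ) * (lam (y - unitVec (fine N M) ν) - lam y))) x|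
          ≤ C * Real.exp (-(δ * D)) * F := by
  have hL1 : 1 < L := by omega
  have hLr : (1 : ℝ) < L := by exact_mod_cast hL1
  have hLr1 : (1 : ℝ) ≤ L := hLr.le
  have hL0 : (0 : ℝ) < L := by linarith
  obtain ⟨C₀, δ₀, hC₀, hδ₀, HW⟩ := fullPropD2_holder_profile_unif (d := d) L hLodd hL ha hm0 hα0 hα1
  -- the rate used inside the levels and the level factor `θ = L^{α−1} < 1`
  set δ₁ : ℝ := min δ₀ 1 with hδ₁def
  have hδ₁0 : 0 < δ₁ := lt_min hδ₀ one_pos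
  have hδ₁δ : δ₁ ≤ δ₀ := min_le_left _ _
  have hδ₁1 : δ₁ ≤ 1 := min_le_right _ _
  set θ : ℝ := (L : ℝ) ^ (α - 1) with hθdef
  have hθ0 : 0 ≤ θ := Real.rpow_nonneg hL0.le _
  have hθ1 : θ < 1 := Real.rpow_lt_one_of_one_lt_of_neg hLr (by linarith)
  have h1θ : 0 < 1 - θ := sub_pos.mpr hθ1
  set A₁ : ℝ := 2 * (8 * ((d : ℝ) + 1) / δ₁) ^ (d + 1) with hA₁def
  have hA₁ : 0 < A₁ := by positivity
  refine ⟨C₀ * Real.exp (δ₀ / 2) * A₁ / (1 - θ), δ₀ / 2, div_pos (by positivity) h1θ, by positivity, ?_⟩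
  intro K hK N _ hN e M _ hM msq hmsq hcap ν lam F D hF x x' hDx hDx'
  have hN1 : (1 : ℝ) ≤ (N : ℝ) := by rw [hN]; exact_mod_cast Nat.one_le_pow K L (by omega)
  have hN0 : 0 < (N : ℝ) := by linarith
  have hNK : ((N : ℝ)) = (L : ℝ) ^ K := by rw [hN, Nat.cast_pow]
  have hF0 : 0 ≤ F := (abs_nonneg _).trans (hF x)
  set c : ℝ := ((N : ℝ) ^ (d + 1))⁻¹ with hcdef
  have hc0 : 0 < c := by positivity
  have hcN : c * (N : ℝ) ^ (d + 1) = 1 := by rw [hcdef, inv_mul_cancel₀ (pow_ne_zero _ hN0.ne')]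
  set w : ℝ := (tdistT (fine N M) x x' / (N : ℝ)) ^ (-α) with hwdef
  have hw0 : 0 ≤ w := Real.rpow_nonneg (div_nonneg (tdistT_nonneg _ _ _) hN0.le) _
  -- the source-gradient kernel at the two observation points (part W-a's object), as a named function
  obtain ⟨MH, hMH⟩ : ∃ f : Tor (fine N M) → ℝ, ∀ y, f y
      = (N : ℝ) * (constrainedProp N M (aK a L K) (((N : ℕ) : ℝ) ^ 2) msq x' (y + unitVec (fine N M) ν)
            - constrainedProp N M (aK a L K) (((N : ℕ) : ℝ) ^ 2) msq x' y)
          - (N : ℝ) * (constrainedProp N M (aK a L K) (((N : ℕ) : ℝ) ^ 2) msq x (y + unitVec (fine N M) ν)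
            - constrainedProp N M (aK a L K) (((N : ℕ) : ℝ) ^ 2) msq x y) := ⟨_, fun _ => rfl⟩
  -- Step A: the difference of the two operator values as a kernel sum (part Q4a + symmetry)
  have hrepr : ((fineOp N M (aK a L K) (((N : ℕ) : ℝ) ^ 2) msq)⁻¹ *ᵥ (fun y => (N : ℝ) * (lam (y - unitVec (fine N M) ν) - lam y))) x'
        - ((fineOp N M (aK a L K) (((N : ℕ) : ℝ) ^ 2) msq)⁻¹ *ᵥ (fun y => (N : ℝ) * (lam (y - unitVec (fine N M) ν) - lam y))) x
      = ∑ y, c * MH y * lam y := by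
    rw [inv_mulVec_adjDeriv_eq_sum, inv_mulVec_adjDeriv_eq_sum, ← Finset.sum_sub_distrib]
    refine Finset.sum_congr rfl fun y _ => ?_
    rw [hMH, constrainedProp_symm N M _ _ _ (y + unitVec (fine N M) ν) x', constrainedProp_symm N M _ _ _ y x',
      constrainedProp_symm N M _ _ _ (y + unitVec (fine N M) ν) x, constrainedProp_symm N M _ _ _ y x]
    ring
  rw [hrepr]
  -- the level sums at the rate `δ₁∕2`, as a named function of the source point
  obtain ⟨S₁, hS₁⟩ : ∃ f : Tor (fine N M) → ℝ, ∀ y, f y = ∑ i ∈ Finset.range K, ((L : ℝ) ^ (d + 1) / (L : ℝ) ^ 2 * L) ^ i * ((L : ℝ) ^ i) ^ α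
      * Real.exp (-(δ₁ / 2 * (min (tdistT (fine N M) x y) (tdistT (fine N M) x' y) * (L : ℝ) ^ i / (N : ℝ)))) := ⟨_, fun _ => rfl⟩
  have hS₁0 : ∀ y, 0 ≤ S₁ y := fun y => by rw [hS₁]; exact Finset.sum_nonneg fun i _ => by positivity
  -- Step B: termwise bound `w·|c·MH(y)·λ(y)| ≤ c·C₀·e^{δ₀∕2}·e^{−(δ₀∕2)D}·F·S₁(y)`
  have hterm : ∀ y, w * |c * MH y * lam y| ≤ c * C₀ * Real.exp (δ₀ / 2) * Real.exp (-(δ₀ / 2 * D)) * F * S₁ y := by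
    intro y
    by_cases hy : lam y = 0
    · rw [hy, mul_zero, abs_zero, mul_zero]
      have := hS₁0 y
      positivity
    -- the weighted kernel profile (part W-a)
    have hprof := HW K hK N hN e M hM msq hmsq hcap ν x x' y
    rw [← hMH y] at hprof
    -- the block decay from the support out of every level: `N·D ≤ m + N − 1`
    set m : ℝ := min (tdistT (fine N M) x y) (tdistT (fine N M) x' y) with hmdef
    have hm0' : 0 ≤ m := le_min (tdistT_nonneg _ _ _) (tdistT_nonneg _ _ _)
    have hDm : (N : ℝ) * D ≤ m + ((N : ℝ) - 1) := by
      have h1 := mul_tdistT_blockOf_le N M x y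
      have h2 := mul_tdistT_blockOf_le N M x' y
      have h3 := mul_le_mul_of_nonneg_left (hDx y hy) hN0.le
      have h4 := mul_le_mul_of_nonneg_left (hDx' y hy) hN0.le
      rcases min_choice (tdistT (fine N M) x y) (tdistT (fine N M) x' y) with h | h <;> rw [hmdef, h] <;> linarith
    have hlev : ∑ i ∈ Finset.range K, ((L : ℝ) ^ (d + 1) / (L : ℝ) ^ 2 * L) ^ i * ((L : ℝ) ^ i) ^ α
          * Real.exp (-(δ₀ * (m * (L : ℝ) ^ i / (N : ℝ))))
        ≤ Real.exp (δ₀ / 2) * Real.exp (-(δ₀ / 2 * D)) * S₁ y := by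
      rw [hS₁, Finset.mul_sum]
      refine Finset.sum_le_sum fun i _ => ?_
      have hs : (1 : ℝ) ≤ (L : ℝ) ^ i := one_le_pow₀ hLr1
      have hsplit := exp_level_split (s := (L : ℝ) ^ i) hδ₀.le hm0' hs hN1 hDm
      have hrate : Real.exp (-(δ₀ / 2 * (m * (L : ℝ) ^ i / (N : ℝ)))) ≤ Real.exp (-(δ₁ / 2 * (m * (L : ℝ) ^ i / (N : ℝ)))) := by
        apply Real.exp_le_exp.mpr
        have h0 : 0 ≤ m * (L : ℝ) ^ i / (N : ℝ) := by positivity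
        nlinarith [mul_le_mul_of_nonneg_right hδ₁δ h0]
      rw [← hmdef]
      calc ((L : ℝ) ^ (d + 1) / (L : ℝ) ^ 2 * L) ^ i * ((L : ℝ) ^ i) ^ α * Real.exp (-(δ₀ * (m * (L : ℝ) ^ i / (N : ℝ))))
          ≤ ((L : ℝ) ^ (d + 1) / (L : ℝ) ^ 2 * L) ^ i * ((L : ℝ) ^ i) ^ α
            * (Real.exp (δ₀ / 2) * Real.exp (-(δ₀ / 2 * D)) * Real.exp (-(δ₁ / 2 * (m * (L : ℝ) ^ i / (N : ℝ))))) :=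
            mul_le_mul_of_nonneg_left (hsplit.trans (mul_le_mul_of_nonneg_left hrate (by positivity))) (by positivity)
        _ = Real.exp (δ₀ / 2) * Real.exp (-(δ₀ / 2 * D))
            * (((L : ℝ) ^ (d + 1) / (L : ℝ) ^ 2 * L) ^ i * ((L : ℝ) ^ i) ^ α
              * Real.exp (-(δ₁ / 2 * (m * (L : ℝ) ^ i / (N : ℝ))))) := by ring
    calc w * |c * MH y * lam y| = c * (w * |MH y|) * |lam y| := by
          rw [abs_mul, abs_mul, abs_of_pos hc0]; ring
      _ ≤ c * (C₀ * (Real.exp (δ₀ / 2) * Real.exp (-(δ₀ / 2 * D)) * S₁ y)) * F := by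
          refine mul_le_mul (mul_le_mul_of_nonneg_left (hprof.trans (mul_le_mul_of_nonneg_left hlev hC₀.le)) hc0.le) (hF y)
            (abs_nonneg _) ?_
          have := hS₁0 y; positivity
      _ = c * C₀ * Real.exp (δ₀ / 2) * Real.exp (-(δ₀ / 2 * D)) * F * S₁ y := by ring
  -- Step C: the levels — `Σ_y S₁(y) ≤ A₁·N^{d+1}·Σ_i θ^i ≤ A₁·N^{d+1}∕(1 − θ)`
  have hlevel : ∀ i ∈ Finset.range K, ((L : ℝ) ^ (d + 1) / (L : ℝ) ^ 2 * L) ^ i * ((L : ℝ) ^ i) ^ α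
      * ∑ y, Real.exp (-(δ₁ / 2 * (min (tdistT (fine N M) x y) (tdistT (fine N M) x' y) * (L : ℝ) ^ i / (N : ℝ))))
        ≤ A₁ * (N : ℝ) ^ (d + 1) * θ ^ i := by
    intro i hi
    have hiK : i < K := Finset.mem_range.mp hi
    have hq1 : (1 : ℝ) ≤ (L : ℝ) ^ i := one_le_pow₀ hLr1
    have hq0 : (0 : ℝ) < (L : ℝ) ^ i := by linarith
    have hqN : (L : ℝ) ^ i ≤ (N : ℝ) := by rw [hNK]; exact pow_le_pow_right₀ hLr1 hiK.le
    -- the two one-point lattice sums at the rate `κ = (δ₁∕2)(L^i∕N) ≤ 1∕2`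
    set κ : ℝ := δ₁ / 2 * ((L : ℝ) ^ i / (N : ℝ)) with hκdef
    have hκ0 : 0 < κ := by positivity
    have hκ1 : κ ≤ ((d + 1 : ℕ) : ℝ) := by
      have h1 : (L : ℝ) ^ i / (N : ℝ) ≤ 1 := (div_le_one hN0).mpr hqN
      have h2 : κ ≤ 1 / 2 * 1 := mul_le_mul (by linarith) h1 (by positivity) (by norm_num)
      have h3 : (1 : ℝ) ≤ ((d + 1 : ℕ) : ℝ) := by exact_mod_cast Nat.le_add_left 1 d
      linarith
    have hLC := latticeConst_le_of_le (d + 1) (by omega) hκ0 hκ1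
    have hκinv : 4 * ((d + 1 : ℕ) : ℝ) / κ = 8 * ((d : ℝ) + 1) * (N : ℝ) / (δ₁ * (L : ℝ) ^ i) := by
      rw [hκdef]; push_cast; field_simp; ring
    rw [hκinv] at hLC
    have hsum : ∑ y, Real.exp (-(δ₁ / 2 * (min (tdistT (fine N M) x y) (tdistT (fine N M) x' y) * (L : ℝ) ^ i / (N : ℝ))))
        ≤ 2 * (8 * ((d : ℝ) + 1) * (N : ℝ) / (δ₁ * (L : ℝ) ^ i)) ^ (d + 1) := by
      have hmin : ∀ y, Real.exp (-(δ₁ / 2 * (min (tdistT (fine N M) x y) (tdistT (fine N M) x' y) * (L : ℝ) ^ i / (N : ℝ))))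
          ≤ Real.exp (-(κ * tdistT (fine N M) x y)) + Real.exp (-(κ * tdistT (fine N M) x' y)) := by
        intro y
        have e1 : ∀ r : ℝ, δ₁ / 2 * (r * (L : ℝ) ^ i / (N : ℝ)) = κ * r := fun r => by rw [hκdef]; ring
        rcases min_choice (tdistT (fine N M) x y) (tdistT (fine N M) x' y) with h | h
        · rw [h, e1]; linarith [Real.exp_pos (-(κ * tdistT (fine N M) x' y))]
        · rw [h, e1]; linarith [Real.exp_pos (-(κ * tdistT (fine N M) x y))]
      calc _ ≤ ∑ y, (Real.exp (-(κ * tdistT (fine N M) x y)) + Real.exp (-(κ * tdistT (fine N M) x' y))) :=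
            Finset.sum_le_sum fun y _ => hmin y
        _ = ∑ y, Real.exp (-(κ * tdistT (fine N M) x y)) + ∑ y, Real.exp (-(κ * tdistT (fine N M) x' y)) :=
            Finset.sum_add_distrib
        _ ≤ latticeConst (d + 1) κ + latticeConst (d + 1) κ :=
            add_le_add (tdistT_sumBound (fine N M) κ hκ0 x) (tdistT_sumBound (fine N M) κ hκ0 x')
        _ ≤ 2 * (8 * ((d : ℝ) + 1) * (N : ℝ) / (δ₁ * (L : ℝ) ^ i)) ^ (d + 1) := by linarith
    -- `(L^d)^i·(L^i)^α·2(8(d+1)N∕(δ₁L^i))^{d+1} = A₁·N^{d+1}·θ^i`, `θ^i = (L^i)^α∕L^i`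
    have hΛ : ((L : ℝ) ^ (d + 1) / (L : ℝ) ^ 2 * L) ^ i = ((L : ℝ) ^ i) ^ d := by
      have hLam : (L : ℝ) ^ (d + 1) / (L : ℝ) ^ 2 * L = (L : ℝ) ^ d := by
        have hL0' : (L : ℝ) ≠ 0 := hL0.ne'
        field_simp
        ring
      rw [hLam, ← pow_mul, ← pow_mul, Nat.mul_comm]
    have hθq : ((L : ℝ) ^ i) ^ α = θ ^ i * (L : ℝ) ^ i := by
      rw [hθdef, ← Real.rpow_natCast (L : ℝ) i, ← Real.rpow_mul hL0.le, show ((i : ℕ) : ℝ) * α = (α - 1) * (i : ℕ) + (i : ℕ) by ring,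
        Real.rpow_add hL0, Real.rpow_mul hL0.le, Real.rpow_natCast, Real.rpow_natCast]
    have h8 : 8 * ((d : ℝ) + 1) * (N : ℝ) / (δ₁ * (L : ℝ) ^ i) = (8 * ((d : ℝ) + 1) / δ₁) * ((N : ℝ) / (L : ℝ) ^ i) :=
      (div_mul_div_comm _ _ _ _).symm
    have halg : ((L : ℝ) ^ i) ^ d * (θ ^ i * (L : ℝ) ^ i) * (2 * (8 * ((d : ℝ) + 1) * (N : ℝ) / (δ₁ * (L : ℝ) ^ i)) ^ (d + 1))
        = A₁ * (N : ℝ) ^ (d + 1) * θ ^ i := by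
      have hqd : ((L : ℝ) ^ i) ^ (d + 1) ≠ 0 := pow_ne_zero _ hq0.ne'
      have hδd : δ₁ ^ (d + 1) ≠ 0 := pow_ne_zero _ hδ₁0.ne'
      rw [hA₁def, h8, mul_pow, div_pow, div_pow]
      rw [show ((L : ℝ) ^ i) ^ d * (θ ^ i * (L : ℝ) ^ i) = θ ^ i * ((L : ℝ) ^ i) ^ (d + 1) by rw [pow_succ]; ring]
      field_simp
    rw [hΛ, hθq]
    calc ((L : ℝ) ^ i) ^ d * (θ ^ i * (L : ℝ) ^ i)
          * ∑ y, Real.exp (-(δ₁ / 2 * (min (tdistT (fine N M) x y) (tdistT (fine N M) x' y) * (L : ℝ) ^ i / (N : ℝ))))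
        ≤ ((L : ℝ) ^ i) ^ d * (θ ^ i * (L : ℝ) ^ i) * (2 * (8 * ((d : ℝ) + 1) * (N : ℝ) / (δ₁ * (L : ℝ) ^ i)) ^ (d + 1)) :=
          mul_le_mul_of_nonneg_left hsum (by positivity)
      _ = A₁ * (N : ℝ) ^ (d + 1) * θ ^ i := halg
  have hΦsum : ∑ y, S₁ y ≤ A₁ * (N : ℝ) ^ (d + 1) * (1 / (1 - θ)) := by
    have hgeom : ∑ i ∈ Finset.range K, θ ^ i ≤ 1 / (1 - θ) := by
      have h := geom_sum_Ico_le_of_lt_one (m := 0) (n := K) hθ0 hθ1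
      rwa [← Finset.range_eq_Ico, pow_zero] at h
    calc ∑ y, S₁ y = ∑ y, ∑ i ∈ Finset.range K, ((L : ℝ) ^ (d + 1) / (L : ℝ) ^ 2 * L) ^ i * ((L : ℝ) ^ i) ^ α
          * Real.exp (-(δ₁ / 2 * (min (tdistT (fine N M) x y) (tdistT (fine N M) x' y) * (L : ℝ) ^ i / (N : ℝ)))) :=
          Finset.sum_congr rfl fun y _ => hS₁ y
      _ = ∑ i ∈ Finset.range K, ∑ y, ((L : ℝ) ^ (d + 1) / (L : ℝ) ^ 2 * L) ^ i * ((L : ℝ) ^ i) ^ α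
          * Real.exp (-(δ₁ / 2 * (min (tdistT (fine N M) x y) (tdistT (fine N M) x' y) * (L : ℝ) ^ i / (N : ℝ)))) :=
          Finset.sum_comm
      _ = ∑ i ∈ Finset.range K, ((L : ℝ) ^ (d + 1) / (L : ℝ) ^ 2 * L) ^ i * ((L : ℝ) ^ i) ^ α
          * ∑ y, Real.exp (-(δ₁ / 2 * (min (tdistT (fine N M) x y) (tdistT (fine N M) x' y) * (L : ℝ) ^ i / (N : ℝ)))) :=
          Finset.sum_congr rfl fun i _ => by rw [Finset.mul_sum]
      _ ≤ ∑ i ∈ Finset.range K, A₁ * (N : ℝ) ^ (d + 1) * θ ^ i := Finset.sum_le_sum hlevel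
      _ = A₁ * (N : ℝ) ^ (d + 1) * ∑ i ∈ Finset.range K, θ ^ i := by rw [Finset.mul_sum]
      _ ≤ A₁ * (N : ℝ) ^ (d + 1) * (1 / (1 - θ)) := mul_le_mul_of_nonneg_left hgeom (by positivity)
  -- assemble
  calc w * |∑ y, c * MH y * lam y| ≤ w * ∑ y, |c * MH y * lam y| :=
        mul_le_mul_of_nonneg_left (Finset.abs_sum_le_sum_abs _ _) hw0
    _ = ∑ y, w * |c * MH y * lam y| := by rw [Finset.mul_sum]
    _ ≤ ∑ y, c * C₀ * Real.exp (δ₀ / 2) * Real.exp (-(δ₀ / 2 * D)) * F * S₁ y := Finset.sum_le_sum fun y _ => hterm y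
    _ = c * C₀ * Real.exp (δ₀ / 2) * Real.exp (-(δ₀ / 2 * D)) * F * ∑ y, S₁ y := by rw [Finset.mul_sum]
    _ ≤ c * C₀ * Real.exp (δ₀ / 2) * Real.exp (-(δ₀ / 2 * D)) * F * (A₁ * (N : ℝ) ^ (d + 1) * (1 / (1 - θ))) :=
        mul_le_mul_of_nonneg_left hΦsum (by positivity)
    _ = (c * (N : ℝ) ^ (d + 1)) * (C₀ * Real.exp (δ₀ / 2) * A₁ / (1 - θ)) * Real.exp (-(δ₀ / 2 * D)) * F := by ring
    _ = C₀ * Real.exp (δ₀ / 2) * A₁ / (1 - θ) * Real.exp (-(δ₀ / 2 * D)) * F := by rw [hcN, one_mul]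

end Summit.QuantumFields.YangMills.BalabanUVNodes.N15KingModelRung.Curved
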